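import Mathlib

/-!
# Every carry cell is reached on a `2^{-k}` grid with `2^k ≥ pq` (stub `stub_gridReach`)

The stub `stub_gridReach` of the crux `MobiusLadder.QuadraticDigitPhases`
(stmt-QuantumAdvantage-1391), line `Sketch`.  Mathlib only; pure `ℕ` arithmetic.

The pair-carry chain of `T ↦ (pT, qT)` (`p ≠ q` odd primes) has, after reading `c` bits `T < 2^c`,
the carry state `(⌊pT/2^c⌋, ⌊qT/2^c⌋) ∈ [0,p) × [0,q)`.  The cells are the pairs `(r, r')` with
`r q < (r'+1) p` and `r' p < (r+1) q`, i.e. the real intervals `[r/p,(r+1)/p)` and `[r'/q,(r'+1)/q)`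
meet.  Writing `a := max (r q) (r' p)`, the interval `[a/(pq), (a+1)/(pq))` lies in their
intersection, and it has length `1/(pq) ≥ 2^{-k}`; hence among the `k`-bit extensions
`x = T + 2^c w` (`w < 2^k`) of any prefix `T < 2^c`, whose ratios `x / 2^{c+k}` form a grid of mesh
`2^{-k}` in `[0,1)`, the least `w` with `a · 2^{c+k} ≤ p q x` also satisfies `p q x < (a+1) · 2^{c+k}`,
so that `⌊p x / 2^{c+k}⌋ = r` and `⌊q x / 2^{c+k}⌋ = r'`.
-/

set_option linter.dupNamespace false -- D-0017: single-problem summit ⇒ `QuantumAdvantage.QuantumAdvantage` by design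

namespace Summit.QuantumAdvantage.QuantumAdvantage.Theorems.MobiusLadderQuadraticDigitPhasesStubGridReach

/-- **Grid reach.**  If `(r, r')` is a carry cell of the pair-carry chain of `T ↦ (pT, qT)`
(`r q < (r'+1) p` and `r' p < (r+1) q`, i.e. `[r/p,(r+1)/p) ∩ [r'/q,(r'+1)/q) ≠ ∅`) and
`2^k ≥ p q`, then from any prefix `T < 2^c` some `k`-bit extension `T + 2^c w` (`w < 2^k`) has
carries `(⌊p(T+2^c w)/2^{c+k}⌋, ⌊q(T+2^c w)/2^{c+k}⌋) = (r, r')`. -/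
theorem stub_gridReach :
    ∀ p q : ℕ, p.Prime → q.Prime → p ≠ q → 2 < p → 2 < q →
      ∀ r r' c T k : ℕ, r < p → r' < q → r * q < (r' + 1) * p → r' * p < (r + 1) * q →
        T < 2 ^ c → p * q ≤ 2 ^ k →
        ∃ w : ℕ, w < 2 ^ k ∧ p * (T + 2 ^ c * w) / 2 ^ (c + k) = r ∧ q * (T + 2 ^ c * w) / 2 ^ (c + k) = r' := by
  intro p q hp hq _ _ _ r r' c T k hrp _ hrq hr'p hT hk
  have hp0 : 0 < p := hp.pos
  have hq0 : 0 < q := hq.pos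
  have hC : 0 < 2 ^ c := Nat.two_pow_pos c
  -- the numerator `a` of the left endpoint `a/(pq)` of the target interval
  obtain ⟨a, hra, hr'a, haq, hap⟩ :
      ∃ a, r * q ≤ a ∧ r' * p ≤ a ∧ a + 1 ≤ (r + 1) * q ∧ a + 1 ≤ (r' + 1) * p := by
    rcases le_total (r * q) (r' * p) with h | h
    · exact ⟨r' * p, h, le_rfl, hr'p, by nlinarith⟩
    · exact ⟨r * q, le_rfl, h, by nlinarith, hrq⟩
  have hapq : a + 1 ≤ p * q := haq.trans (Nat.mul_le_mul_right q hrp)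
  rw [pow_add]
  -- a good `w` exists (`w = 2^k`), take the least one
  have hex : ∃ w, a * (2 ^ c * 2 ^ k) ≤ p * q * (T + 2 ^ c * w) := by
    refine ⟨2 ^ k, ?_⟩
    calc a * (2 ^ c * 2 ^ k) ≤ p * q * (2 ^ c * 2 ^ k) := Nat.mul_le_mul_right _ (by omega)
      _ ≤ p * q * (T + 2 ^ c * 2 ^ k) := Nat.mul_le_mul_left _ (Nat.le_add_left _ _)
  obtain ⟨w, hw, hmin⟩ : ∃ w, a * (2 ^ c * 2 ^ k) ≤ p * q * (T + 2 ^ c * w) ∧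
      ∀ v, v < w → ¬ a * (2 ^ c * 2 ^ k) ≤ p * q * (T + 2 ^ c * v) :=
    ⟨Nat.find hex, Nat.find_spec hex, fun v hv => Nat.find_min hex hv⟩
  have hkC : p * q * 2 ^ c ≤ 2 ^ k * 2 ^ c := Nat.mul_le_mul_right _ hk
  -- the least good `w` also satisfies the upper bound
  have hw' : p * q * (T + 2 ^ c * w) < (a + 1) * (2 ^ c * 2 ^ k) := by
    rcases w with _ | v
    · have h1 : p * q * T < p * q * 2 ^ c := Nat.mul_lt_mul_of_pos_left hT (Nat.mul_pos hp0 hq0)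
      rw [mul_zero, add_zero]
      calc p * q * T < p * q * 2 ^ c := h1
        _ ≤ 2 ^ k * 2 ^ c := hkC
        _ = 1 * (2 ^ c * 2 ^ k) := by ring
        _ ≤ (a + 1) * (2 ^ c * 2 ^ k) := Nat.mul_le_mul_right _ (by omega)
    · have hv : p * q * (T + 2 ^ c * v) < a * (2 ^ c * 2 ^ k) :=
        Nat.lt_of_not_le (hmin v (Nat.lt_succ_self v))
      nlinarith
  refine ⟨w, ?_, ?_, ?_⟩
  · -- `w < 2^k`
    have h1 : p * q * (T + 2 ^ c * w) < p * q * (2 ^ c * 2 ^ k) :=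
      hw'.trans_le (Nat.mul_le_mul_right _ hapq)
    have h2 : T + 2 ^ c * w < 2 ^ c * 2 ^ k := Nat.lt_of_mul_lt_mul_left h1
    have h3 : 2 ^ c * w < 2 ^ c * 2 ^ k := by omega
    exact Nat.lt_of_mul_lt_mul_left h3
  · -- `⌊p x / 2^{c+k}⌋ = r`
    refine Nat.div_eq_of_lt_le ?_ ?_
    · refine Nat.le_of_mul_le_mul_left ?_ hq0
      calc q * (r * (2 ^ c * 2 ^ k)) = r * q * (2 ^ c * 2 ^ k) := by ring
        _ ≤ a * (2 ^ c * 2 ^ k) := Nat.mul_le_mul_right _ hra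
        _ ≤ p * q * (T + 2 ^ c * w) := hw
        _ = q * (p * (T + 2 ^ c * w)) := by ring
    · refine Nat.lt_of_mul_lt_mul_left (a := q) ?_
      calc q * (p * (T + 2 ^ c * w)) = p * q * (T + 2 ^ c * w) := by ring
        _ < (a + 1) * (2 ^ c * 2 ^ k) := hw'
        _ ≤ (r + 1) * q * (2 ^ c * 2 ^ k) := Nat.mul_le_mul_right _ haq
        _ = q * ((r + 1) * (2 ^ c * 2 ^ k)) := by ring
  · -- `⌊q x / 2^{c+k}⌋ = r'`
    refine Nat.div_eq_of_lt_le ?_ ?_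
    · refine Nat.le_of_mul_le_mul_left ?_ hp0
      calc p * (r' * (2 ^ c * 2 ^ k)) = r' * p * (2 ^ c * 2 ^ k) := by ring
        _ ≤ a * (2 ^ c * 2 ^ k) := Nat.mul_le_mul_right _ hr'a
        _ ≤ p * q * (T + 2 ^ c * w) := hw
        _ = p * (q * (T + 2 ^ c * w)) := by ring
    · refine Nat.lt_of_mul_lt_mul_left (a := p) ?_
      calc p * (q * (T + 2 ^ c * w)) = p * q * (T + 2 ^ c * w) := by ring
        _ < (a + 1) * (2 ^ c * 2 ^ k) := hw'
        _ ≤ (r' + 1) * p * (2 ^ c * 2 ^ k) := Nat.mul_le_mul_right _ hap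
        _ = p * ((r' + 1) * (2 ^ c * 2 ^ k)) := by ring

end Summit.QuantumAdvantage.QuantumAdvantage.Theorems.MobiusLadderQuadraticDigitPhasesStubGridReach
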